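import Mathlib

/-!
# B3 ROOM LAW PER BIT CLASS — kernel companion (hsemireg-monad-4 g19)

token: `line stmt-HodgeConjecture-18881 Cruxes/BlochSeedDiscOne/Lines/birth.lean 814a6a70c14e831a stub_rung_pad4_seedAt`

Companion of the memo `B3-ROOMLAW-BITCLASS-monad4-g19.md` (same folder).  What is checked here is
FINITE ARITHMETIC about the BLOCK-TRACE-TW count law of record (g15 §2.4, g18 §3) in the form the memo
uses after BIT RE-LETTERING (idea-crit-hsem-2 memo-112 RIDER R-B; g16 §2.3 (iv) BIT REVIVAL):

* `term m σ = (m − σ)·m` is the contribution of one isomorphism class of `m` block copies with `σ`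
  credited columns on one factor (orphan-only blocks, `t = 0`); with the letter surrogate `σ = min m e`
  (`e` = number of EQ_f-feeders alive for the class: `4` plain ∕ flip, `8` τ-sym, `0` on a factor carrying a
  genuinely continuous twist) a room is BT-silent on factor `f` iff the POOLED sum of the terms of all
  q-null N36 classes is `≤ 1` (one shared trace condition per factor for the whole flat-twist orbit,
  memo §1.3 LEMMA ORBIT POOLING, pen).
* the sixteen N36 bit classes, the twelve q-null ones, the four APEX ones, and the one-bit-flip
  RE-LETTERING graph (each apex class has exactly four q-null neighbours, all of odd weight; each odd class
  has exactly two apex neighbours) — by `decide`;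
* the table rows quoted in the memo: `a32-dblC5` as TABLED (apex `m = 5`): pooled count 19 per factor (76),
  per-letter count 16 per factor (64, g18); `a32♭` (apex 4, four distinct odd neighbours 3): silent, apex
  margin 0; the orbit ceiling 12 × 4 aligned (+ 4 deficiency-disjoint continuous singletons = the `c = 9`
  room): silent; one more aligned copy: not; τ-sym cap 8 per class; `a24-dblC3-sym` apex margin 5.

Nothing here is a statement about sheaves, monads, semiregularity or a seed; the dictionary from these
digits to THEOREM BLOCK-TRACE-TW is the memo's (pen).  Mathlib only; no `sorry`, no `instance`, no
`notation`, no unsafe options.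
-/

set_option linter.dupNamespace false

namespace Summit.HodgeConjecture.HodgeConjecture.Cruxes.BlochSeedDiscOne.RoomLawBitClass

/-! ## §1 The term law (one class, one factor) -/

/-- BLOCK-TRACE-TW contribution of a class of `m` copies with `σ` credited columns (t = 0). -/
def term (m σ : ℕ) : ℕ := (m - σ) * m

/-- Letter surrogate of the credited rank: `σ ≤ min m e` (e = live EQ_f-feeders of the class);
with generic maps ((M0)-type open condition) equality holds. -/
def sigmaSur (m e : ℕ) : ℕ := min m e

/-- The aligned ∕ surrogate term of a class of `m` copies with `e` live EQ_f-feeders. -/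
def aterm (m e : ℕ) : ℕ := term m (sigmaSur m e)

theorem term_eq_zero_iff (m σ : ℕ) : term m σ = 0 ↔ m ≤ σ ∨ m = 0 := by
  unfold term
  rw [Nat.mul_eq_zero]
  constructor
  · rintro (h | h)
    · left; omega
    · right; exact h
  · rintro (h | h)
    · left; omega
    · right; exact h

theorem term_eq_one_iff (m σ : ℕ) : term m σ = 1 ↔ m = 1 ∧ σ = 0 := by
  unfold term
  constructor
  · intro h
    have hm : m = 1 := Nat.dvd_one.mp (Dvd.intro_left (m - σ) h)
    subst hm
    simp at h
    omega
  · rintro ⟨rfl, rfl⟩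
    simp

/-- A class of `m ≥ 2` copies with NO credited column on a factor costs at least 4 there
(so every genuinely twisted class must be a singleton: ROOM LAW (b♭)). -/
theorem four_le_term_of_two_le (m : ℕ) (hm : 2 ≤ m) : 4 ≤ term m 0 := by
  unfold term
  simp only [Nat.sub_zero]
  nlinarith

/-- CAP PER CLASS: an aligned (or re-lettered) class with `e` live EQ_f-feeders is silent on that factor
iff `m ≤ e` — per q-null N36 bit class at most `e` copies (4 plain ∕ flip, 8 τ-sym). -/
theorem aterm_eq_zero_iff (m e : ℕ) : aterm m e = 0 ↔ m ≤ e := by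
  unfold aterm sigmaSur
  rw [term_eq_zero_iff]
  constructor
  · rintro (h | h)
    · by_contra hc
      have hc' : e < m := not_le.mp hc
      rw [Nat.min_eq_right (le_of_lt hc')] at h
      omega
    · omega
  · intro h
    left
    rw [Nat.min_eq_left h]

/-- Past the cap by one the class alone already breaks silence on every factor (`(e+1−e)(e+1) = e+1 ≥ 2`). -/
theorem aterm_succ_cap (e : ℕ) (he : 1 ≤ e) : 2 ≤ aterm (e + 1) e := by
  unfold aterm sigmaSur term
  rw [Nat.min_eq_right (Nat.le_succ e)]
  simp
  omega

/-- Pooling is never weaker than counting letter by letter: `[T₁ + T₂ − 1]₊ ≥ [T₁ − 1]₊ + [T₂ − 1]₊`. -/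
theorem pooled_ge_split (T₁ T₂ : ℕ) : (T₁ - 1) + (T₂ - 1) ≤ (T₁ + T₂) - 1 := by omega

/-! ## §2 Per-factor pooled count of a room

A room, on one factor `f`, is a list of classes `(m, e)` — `m` copies, `e` live EQ_f-feeders
(after bit re-lettering: `e = 4` if the class carries no continuous twist on `f`, else `0`; τ-sym: 8). -/

/-- sum of the class terms on one factor -/
def termSum (cls : List (ℕ × ℕ)) : ℕ := (cls.map fun p => aterm p.1 p.2).sum

/-- pooled BLOCK-TRACE-TW digit of the factor: `[Σ terms − 1]₊` -/
def pooledF (cls : List (ℕ × ℕ)) : ℕ := termSum cls - 1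

/-- per-letter digit of g15∕g18 (each class its own `−1`): `Σ [term − 1]₊` -/
def perLetterF (cls : List (ℕ × ℕ)) : ℕ := (cls.map fun p => aterm p.1 p.2 - 1).sum

/-- BT-silence of the factor (Boolean table entry): pooled digit zero, i.e. `Σ terms ≤ 1`. -/
def silentF (cls : List (ℕ × ℕ)) : Bool := decide (termSum cls ≤ 1)

/-! ## §3 The sixteen N36 bit classes and the re-lettering graph -/

/-- a bit class `b = (b₁, b₂, b₃, b₄)` -/
abbrev Bits := Fin 2 × Fin 2 × Fin 2 × Fin 2

def b1 (b : Bits) : Fin 2 := b.1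
def b2 (b : Bits) : Fin 2 := b.2.1
def b3 (b : Bits) : Fin 2 := b.2.2.1
def b4 (b : Bits) : Fin 2 := b.2.2.2

/-- weight = number of bits set -/
def weight (b : Bits) : ℕ := (b1 b).val + (b2 b).val + (b3 b).val + (b4 b).val

/-- the four N36 classes WITH a q-arrow (to the hubs P83) are 0000, 0101, 1010, 1111 (g18 §2.1):
`b₁ = b₃ ∧ b₂ = b₄`; the other twelve are q-NULL (blocks). -/
def qNull (b : Bits) : Bool := !(decide (b1 b = b3 b) && decide (b2 b = b4 b))

/-- APEX classes of the CAP ray: the q-null classes of weight two (0011, 0110, 1100, 1001). -/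
def apex (b : Bits) : Bool := qNull b && decide (weight b = 2)

/-- flip bit `h` (re-lettering by η on factor `h`) -/
def flip (h : Fin 4) (b : Bits) : Bits :=
  match h with
  | 0 => (b1 b + 1, b2 b, b3 b, b4 b)
  | 1 => (b1 b, b2 b + 1, b3 b, b4 b)
  | 2 => (b1 b, b2 b, b3 b + 1, b4 b)
  | 3 => (b1 b, b2 b, b3 b, b4 b + 1)

theorem card_qNull : (Finset.univ.filter fun b : Bits => qNull b = true).card = 12 := by decide
theorem card_apex : (Finset.univ.filter fun b : Bits => apex b = true).card = 4 := by decide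
theorem apex_list : ∀ b : Bits, apex b = true ↔
    (b = (0,0,1,1) ∨ b = (0,1,1,0) ∨ b = (1,1,0,0) ∨ b = (1,0,0,1)) := by decide
theorem card_odd_qNull :
    (Finset.univ.filter fun b : Bits => qNull b = true ∧ weight b % 2 = 1).card = 8 := by decide
/-- every odd-weight class is q-null (the non-null classes have even weight) -/
theorem odd_is_qNull : ∀ b : Bits, weight b % 2 = 1 → qNull b = true := by decide

/-- RE-LETTERING GRAPH (a): every one-bit flip of an apex class is q-null and of odd weight —
an η-twisted apex copy is re-lettered into a one- or three-bit BLOCK class, never into a hub-feeding class. -/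
theorem apex_flip_qNull_odd : ∀ b : Bits, apex b = true →
    ∀ h : Fin 4, qNull (flip h b) = true ∧ weight (flip h b) % 2 = 1 := by decide

/-- (b): the four flips of an apex class are pairwise distinct (four distinct neighbours). -/
theorem apex_flip_injective : ∀ b : Bits, apex b = true →
    ∀ h h' : Fin 4, flip h b = flip h' b → h = h' := by decide

/-- (c): every odd class has exactly two apex neighbours. -/
theorem odd_two_apex_neighbours : ∀ b : Bits, weight b % 2 = 1 →
    (Finset.univ.filter fun h : Fin 4 => apex (flip h b) = true).card = 2 := by decide

/-- (d): a TWO-bit flip of an apex class is either apex again or NOT q-null (acquires a q-arrow). -/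
theorem apex_two_flips : ∀ b : Bits, apex b = true → ∀ h h' : Fin 4, h ≠ h' →
    (apex (flip h' (flip h b)) = true ∨ qNull (flip h' (flip h b)) = false) := by decide

/-! ## §4 Orbit capacity (plain ∕ flip: e = 4; τ-sym: e = 8) -/

/-- CAPACITY: if each of the twelve q-null classes holds at most `e` aligned copies and at most four
continuous singletons exist in the orbit (one deficient singleton per factor), the q-null N36 mass is
`≤ 12 e + 4` (52 plain, 100 sym). -/
theorem orbit_capacity (e : ℕ) (ms : Fin 12 → ℕ) (s : ℕ) (hm : ∀ i, ms i ≤ e) (hs : s ≤ 4) :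
    (∑ i, ms i) + s ≤ 12 * e + 4 := by
  have : (∑ i, ms i) ≤ ∑ _i : Fin 12, e := Finset.sum_le_sum fun i _ => hm i
  simp at this
  omega

/-- On the CAP ray `a(4c+12)-dblC(c)` the N36 multiset is {apex: c ×4, others: 2 ×12}; the q-null mass is
`4c + 16`; re-lettering room exists iff `4c + 16 ≤ 48` iff `c ≤ 8`, plus ≤ 4 singletons: `c ≤ 9`. -/
theorem ray_qnull_mass (c : ℕ) : 4 * c + 8 * 2 = 4 * c + 16 := by ring
theorem ray_reletter_bound (c : ℕ) : 4 * c + 16 ≤ 12 * 4 ↔ c ≤ 8 := by omega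
theorem ray_room_bound (c : ℕ) : 4 * c + 16 ≤ 12 * 4 + 4 ↔ c ≤ 9 := by omega
theorem ray_sym_reletter_bound (c : ℕ) : 4 * c + 16 ≤ 12 * 8 ↔ c ≤ 20 := by omega

/-! ## §5 Table rows (one factor; by the symmetry of the feeder table every factor reads the same unless a
continuous singleton is placed on it) -/

/-- `a32-dblC5` AS TABLED, aligned room, any factor: apex (5,4) ×4, odd (2,4) ×8. -/
def a32_tabled : List (ℕ × ℕ) := List.replicate 4 (5, 4) ++ List.replicate 8 (2, 4)
theorem a32_tabled_terms : termSum a32_tabled = 20 := by decide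
theorem a32_tabled_pooled : pooledF a32_tabled = 19 := by decide           -- × 4 factors = 76
theorem a32_tabled_perLetter : perLetterF a32_tabled = 16 := by decide     -- × 4 factors = 64 (g18 β)
theorem a32_tabled_not_silent : silentF a32_tabled = false := by decide

/-- `a32♭` = the same numerical class re-lettered: apex (4,4) ×4, loaded odd (3,4) ×4, other odd (2,4) ×4. -/
def a32_flat : List (ℕ × ℕ) := List.replicate 4 (4, 4) ++ List.replicate 4 (3, 4) ++ List.replicate 4 (2, 4)
theorem a32_flat_silent : silentF a32_flat = true := by decide
theorem a32_flat_terms : termSum a32_flat = 0 := by decide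
/-- margins `e − m`: apex 0 (sixteen (M0) determinants), loaded odd 1, rest 2 -/
theorem a32_flat_margins : (4 - 4, 4 - 3, 4 - 2) = ((0 : ℕ), (1 : ℕ), (2 : ℕ)) := by decide

/-- ORBIT CEILING, aligned: all twelve q-null classes at 4 (q-null mass 48; on the ray: c = 8 re-lettered). -/
def orbit48 : List (ℕ × ℕ) := List.replicate 12 (4, 4)
theorem orbit48_silent : silentF orbit48 = true := by decide
/-- one more ALIGNED copy anywhere breaks it on every factor: (5,4) contributes 5. -/
theorem orbit49_aligned_dead : silentF ((5, 4) :: List.replicate 11 (4, 4)) = false := by decide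

/-- THE `c = 9` ROOM (q-null mass 52): orbit48 ⊕ four continuous singletons j₁..j₄, j_h twisted on factor h
only (λ_h ∈ K_{u_h} ∖ {0, η}): read on factor f, the singleton j_f has e = 0 (term 1), the other three have
e = 4 (term 0): Σ = 1 ⇒ silent on every factor. -/
def room52 (onThisFactor others : ℕ) : List (ℕ × ℕ) :=
  orbit48 ++ List.replicate onThisFactor (1, 0) ++ List.replicate others (1, 4)
theorem room52_silent : silentF (room52 1 3) = true := by decide
/-- two singletons deficient on the SAME factor: Σ = 2 ⇒ COUNT-FAIL there (ROOM LAW (c♭)). -/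
theorem room_two_deficient_dead : silentF (room52 2 2) = false := by decide
/-- a twisted PAIR (class of 2 copies with a continuous twist on this factor): term 4 ⇒ dead (ROOM LAW (b♭)). -/
theorem room_twisted_pair_dead : silentF (orbit48 ++ [(2, 0)]) = false := by decide

/-- g18's dead row «3 ⊕ 1 ⊕ 1, both singletons bare on ONE factor» vs the critic's r-iv «m₀ ⊕ 1^{5−m₀},
singletons deficient on DISTINCT factors» — per letter both digits are right; POOLED over the four apex
classes, four apex blocks in rooms m₀ ⊕ 1^{5−m₀} carry 4(5 − m₀) singletons, silent only if ≤ 1 per factor. -/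
theorem riv_perLetter_silent : silentF ([(3, 4), (1, 0), (1, 4)]) = true := by decide
theorem riv_pooled_two_apex_same_factor : silentF ([(3, 4), (1, 0), (1, 4), (3, 4), (1, 0), (1, 4)]) = false := by
  decide
theorem riv_pooled_singletons (m₀ : ℕ) (h : m₀ ≤ 5) : 4 * (5 - m₀) ≤ 4 ↔ 4 ≤ m₀ := by omega

/-- τ-SYM (e = 8): cap 8 per class; `a24-dblC3-sym` apex (3,8): margin 5; `a28-dblC4-sym` margin 4. -/
theorem sym_cap : aterm 8 8 = 0 ∧ aterm 9 8 = 9 := by decide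
theorem sym_margins : (8 - 3, 8 - 4) = ((5 : ℕ), (4 : ℕ)) := by decide
def a24sym_flat : List (ℕ × ℕ) := List.replicate 4 (3, 8) ++ List.replicate 8 (2, 8)
theorem a24sym_silent : silentF a24sym_flat = true := by decide

/-- M1 `a24-dblC3` (apex 3): margin 1; `a28-dblC4` (apex 4): margin 0 — unchanged from g16∕g18. -/
theorem m1_m5_rows : silentF (List.replicate 4 (3, 4) ++ List.replicate 8 (2, 4)) = true ∧
    silentF (List.replicate 4 (4, 4) ++ List.replicate 8 (2, 4)) = true := by decide

end Summit.HodgeConjecture.HodgeConjecture.Cruxes.BlochSeedDiscOne.RoomLawBitClass
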